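import Literature.Computability.Cryptography.HashAndSignOTS
import HarnessLib

/-!
# Padding the values of a universal one-way hash family to a polynomial length

Topic `Literature/Computability/Cryptography`; companion of `UOWHF.lean` (Goldreich 2004, Def. 6.4.18:
`HashCollection`, `IsUOWHF ℓ` with the range specifier `ℓ`, `h_s : {0,1}* → {0,1}^{ℓ(|s|)}`). The one-time
hash-and-sign step of the tree (`HashAndSignOTSIndexed.lean`, Goldreich 2004, Prop. 6.4.31) signs the hashed
value with Lamport's LENGTH-RESTRICTED scheme, whose restriction length must be a polynomial; the range specifier
of the family obtained from a one-way function (`InaccessibleEntropyUOWHFFamily.lean`, `rLen`) is polynomially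
bounded but written with powers of two of logarithmic quantities, not as a polynomial. The remedy is the trivial
one: pad every value `h_s(x)` with zeros to a polynomial length `P(|s|) ≥ ℓ(|s|)`. Designated collisions are
unchanged (two values under the same index have the same length `ℓ(|s|)`, hence the same padding), the index
sampler is untouched, and evaluation stays polynomial-time:

* `HashCollection.padOut H P` — `h'_s(x) = h_s(x) · 0^{P(|s|) − |h_s(x)|}`, same `I`; `indexPMF_padOut`,
  `hasRange_padOut`, `isAdmissible_padOut`, `isEfficient_padOut`, `tcrProb_padOut` (equality of the
  probabilities (6.7));
* **`HashCollection.IsUOWHF.padOut`** — `H.IsUOWHF ℓ → (∀ L, ℓ L ≤ P L) → (H.padOut P).IsUOWHF P`;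
* `HashCollection.IsUOWHF.exists_poly_range_le` — every UOWHF has a polynomially bounded range specifier
  (`ℓ(|s|) = |h_s(ε)|` and evaluation is polynomial-time), whence **`HashCollection.IsUOWHF.exists_polyRange`**:
  from any UOWHF, one with the SAME index sampler and a polynomial range specifier.

Everything is proved; no named facts. (Goldreich treats range specifiers as arbitrary functions; that padding
preserves Def. 6.4.18 is implicit in the text — e.g. footnote 34 and Exercise 21 manipulate lengths freely —
and is recorded here as folklore with the definition as its citation.)

## References

* O. Goldreich, *Foundations of Cryptography II: Basic Applications*, CUP 2004, §6.4.3.1, Def. 6.4.18 (the range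
  specifier; conditions 1–3), Eq. (6.7).
* M. Naor, M. Yung, *Universal one-way hash functions and their cryptographic applications*, STOC 1989, §2.
-/

namespace Literature.Computability.Cryptography

open Filter Asymptotics _root_.Computability Complexity Polynomial
open Complexity.Brick Complexity.Plumb

namespace HashCollection

variable (H : HashCollection) (P : Polynomial ℕ)

/-- **Padding the values**: `h'_s(x) = h_s(x) 0^{P(|s|) − |h_s(x)|}`, with the same index sampler.
[Goldreich 2004, Def. 6.4.18 (range specifier)] [cite: Goldreich2004, Def. 6.4.18] -/
noncomputable def padOut : HashCollection :=
  ⟨H.index, fun s x => H.hash s x ++ List.replicate (P.eval s.length - (H.hash s x).length) false⟩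

/-- The padded family has the same index law (definitional). [folklore] -/
theorem indexPMF_padOut (n : ℕ) : (H.padOut P).indexPMF n = H.indexPMF n := rfl

/-- The padded value. [folklore] -/
theorem padOut_hash (s x : List Bool) :
    (H.padOut P).hash s x = H.hash s x ++ List.replicate (P.eval s.length - (H.hash s x).length) false := rfl

variable {H P}

/-- **Range**: if `ℓ ≤ P` then the padded family has range specifier `P`. [Goldreich 2004, Def. 6.4.18]
[cite: Goldreich2004, Def. 6.4.18] -/
theorem hasRange_padOut {ℓ : ℕ → ℕ} (hR : H.HasRange ℓ) (hP : ∀ L, ℓ L ≤ P.eval L) :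
    (H.padOut P).HasRange fun L => P.eval L := fun s x => by
  rw [padOut_hash, List.length_append, List.length_replicate, hR]
  have := hP s.length
  show ℓ s.length + (P.eval s.length - ℓ s.length) = P.eval s.length
  omega

/-- **Admissibility** is a property of the index sampler alone, hence preserved. [Goldreich 2004, Def. 6.4.18 (1)]
[cite: Goldreich2004, Def. 6.4.18] -/
theorem isAdmissible_padOut (h : H.IsAdmissible) : (H.padOut P).IsAdmissible := h

variable (H P) in
/-- The padded evaluation as a string function on `⟨s, x⟩`: `hFn H w ++ zeros`. [folklore] -/
noncomputable def padFn : List Bool → List Bool :=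
  fun w => HashSign.hFn H w ++ (Kannan.zerosFn ∘ dropFn ∘ fanoutFn (HashSign.hFn H) (polyFn P ∘ fstF)) w

/-- Value of the padded evaluation brick. [folklore] -/
theorem padFn_boolPair (s x : List Bool) : padFn H P (boolPair s x) = (H.padOut P).hash s x := by
  simp [padFn, HashSign.hFn, padOut_hash]

/-- The padded evaluation brick is polynomial-time. [folklore] -/
theorem padFn_mem_FP (hh : PolyTimeComputable pairCode (id : List Bool → List Bool) (fun p : List Bool × List Bool => H.hash p.1 p.2)) :
    padFn H P ∈ FP :=
  append_mem_FP (HashSign.hFn_mem_FP hh) (comp_mem_FP Kannan.zerosFn_mem_FP (comp_mem_FP dropFn_mem_FP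
    (fanoutFn_mem_FP (HashSign.hFn_mem_FP hh) (comp_mem_FP (polyFn_mem_FP P) fstF_mem_FP))))

/-- **Efficiency** is preserved (append `P(|s|) − |h_s(x)|` zeros). [Goldreich 2004, Def. 6.4.18 (2)]
[cite: Goldreich2004, Def. 6.4.18] -/
theorem isEfficient_padOut (h : H.IsEfficient) : (H.padOut P).IsEfficient := by
  refine ⟨h.1, ?_⟩
  refine PolyTimeComputable.of_encode (padFn_mem_FP (P := P) h.2) pairCode (fun _ => rfl) fun p => ?_
  exact padFn_boolPair p.1 p.2

/-- **Designated collisions are unchanged**: under a range specifier, two values under one index have equal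
lengths, so their paddings agree and cancel. [Goldreich 2004, Def. 6.4.18, Eq. (6.7)] [cite: Goldreich2004, Def. 6.4.18] -/
theorem isDesignatedCollision_padOut_iff {ℓ : ℕ → ℕ} (hR : H.HasRange ℓ) (t : List Bool × List Bool × List Bool) :
    (H.padOut P).IsDesignatedCollision t ↔ H.IsDesignatedCollision t := by
  simp only [IsDesignatedCollision, padOut_hash]
  refine and_congr_left fun _ => ⟨fun h => ?_, fun h => by rw [h]⟩
  rw [hR, hR] at h
  exact List.append_cancel_right h

/-- **The probabilities (6.7) agree.** [Goldreich 2004, Def. 6.4.18, Eq. (6.7)] [cite: Goldreich2004, Def. 6.4.18] -/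
theorem tcrProb_padOut {ℓ : ℕ → ℕ} (hR : H.HasRange ℓ) (q : ℕ → ℕ) (A₀ : List Bool → List Bool)
    (A : RandAlg (List Bool) (List Bool)) (n : ℕ) : (H.padOut P).tcrProb q A₀ A n = H.tcrProb q A₀ A n := by
  unfold tcrProb
  have hE : {t | (H.padOut P).IsDesignatedCollision t} = {t | H.IsDesignatedCollision t} :=
    Set.ext fun t => isDesignatedCollision_padOut_iff hR t
  rw [hE]
  rfl

/-- **Padding a UOWHF to a polynomial range is a UOWHF.** [Goldreich 2004, Def. 6.4.18] [cite: Goldreich2004, Def. 6.4.18] -/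
theorem IsUOWHF.padOut {ℓ : ℕ → ℕ} (h : H.IsUOWHF ℓ) (hP : ∀ L, ℓ L ≤ P.eval L) :
    (H.padOut P).IsUOWHF fun L => P.eval L :=
  ⟨isEfficient_padOut h.1, hasRange_padOut h.2.1 hP, isAdmissible_padOut h.2.2.1, fun q A₀ hA₀ A hA => by
    have e : (H.padOut P).tcrProb (fun n => q.eval n) A₀ A = H.tcrProb (fun n => q.eval n) A₀ A :=
      funext fun n => tcrProb_padOut h.2.1 _ A₀ A n
    rw [e]
    exact h.2.2.2 q A₀ hA₀ A hA⟩

/-- **Every UOWHF has a polynomially bounded range specifier**: `ℓ(L) = |h_{0^L}(ε)|`, a polynomial-time value.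
[Goldreich 2004, Def. 6.4.18 (2)] [cite: Goldreich2004, Def. 6.4.18] -/
theorem IsUOWHF.exists_poly_range_le {ℓ : ℕ → ℕ} (h : H.IsUOWHF ℓ) : ∃ P : Polynomial ℕ, ∀ L, ℓ L ≤ P.eval L := by
  obtain ⟨p, hp⟩ := exists_poly_length_le_of_mem_FP (HashSign.hFn_mem_FP h.1.2)
  refine ⟨p.comp (C 2 * X + C 2), fun L => ?_⟩
  have h1 := hp (boolPair (List.replicate L false) [])
  rw [HashSign.hFn, fstF_boolPair, sndF_boolPair, h.2.1, List.length_replicate, length_boolPair, List.length_replicate,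
    List.length_nil] at h1
  simpa [eval_comp] using h1

/-- **From any UOWHF, one with the same index sampler and a polynomial range specifier.** [Goldreich 2004,
Def. 6.4.18] [cite: Goldreich2004, Def. 6.4.18] -/
theorem IsUOWHF.exists_polyRange {ℓ : ℕ → ℕ} (h : H.IsUOWHF ℓ) :
    ∃ (H' : HashCollection) (P : Polynomial ℕ), H'.IsUOWHF (fun L => P.eval L) ∧ H'.index = H.index := by
  obtain ⟨P, hP⟩ := h.exists_poly_range_le
  exact ⟨H.padOut P, P, h.padOut hP, rfl⟩

end HashCollection

end Literature.Computability.Cryptography
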